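import Mathlib
import Literature.Analysis.FluidPDE.VectorCalculus
import Summits.NavierStokesRegularity.NavierStokesRegularity.Theorems.FilamentSkeletonRssSelectionBoxRJRungCutoffShooting

/-!
# Route `FilamentSkeletonRss` · crux `SkeletonJ1R` (stmt-NavierStokesRegularity-23610) · registered line `streamline_kantorovich_R`
# — brick F(i)-a for stub F `LiaFrameL`: the line Biot–Savart field with a general core constant, its smoothness, and global
# shooting for the POSITION-cut-off local-induction equation

Lead `ns-fsr-lead-23610` (g0), `--supports stmt-NavierStokesRegularity-23610 --as helper`; route-independent (no `Theses` import, no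
line-vocabulary import: the instantiation to `SkeletonJ1RFrame.IsLiaReference` is a one-line corollary once the Defs file
`…SkeletonJ1RFrameDefs.lean` has landed).

WHAT.  Stub F(i) of the registered skeleton (`Cruxes/SkeletonJ1R/Lines/streamline_kantorovich_R.lean`) asks for the LIA REFERENCE: unit-speed
`C²` curves solving `x″ = (β⁻¹ φ(x)) • x′ × W(x)` where `φ` is a smooth cutoff of POSITION (not of the parameter, unlike the rung ladder's
`…RungModelArc`) and `W` = the regularised Biot–Savart field of the partners' straight datum lines (core constant
`a = exp(−(1+γ_E−log 2))`, NOT `1`) plus the frame field `½y − αe₃×y`.  This file supplies the three Γ-free ingredients: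

* `integral_lineKernel_core` — `∫ ((u² + A)^{3/2})⁻¹ du = 2/A` for every `A > 0` (the `SkeletonEquilibrium.Sketch` version of the tree is
  private and needs `A ≥ 1`);
* `lineBiotSavart_core` — for a core constant `a > 0`, a unit direction `t` and a base point `W`,
  `∫ ((‖y − (W + σt)‖² + a)^{3/2})⁻¹ • t × (y − (W + σt)) dσ = (2/(‖y − W‖² − ⟪y − W, t⟫² + a)) • t × (y − W)` (+ integrability):
  the closed form that makes the ambient field an explicit smooth rational expression;
* `contDiff_lineField` — `y ↦ (2/(‖y − W‖² − ⟪y − W, t⟫² + a)) • t × (y − W)` is `C^∞` (`a > 0`, `‖t‖ = 1`), with the pointwise bound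
  `‖…‖ ≤ 2 d/(d² + a)` where `d = dist(y, line)` (`norm_lineField_le`);
* `positionCutoffLia_exists` / `_unique` — for `φ : ℝ³ → ℝ` and `W : ℝ³ → ℝ³` both `C¹`, any `b : ℝ` and Cauchy data `(P, e)`, `‖e‖ = 1`,
  the equation `x″ = (b * φ(x)) • x′ × W(x)` has a unique global `C²` unit-speed solution (the tree's `SelectionBoxRJRung.cutoffShooting_exists`
  with the jointly-`C¹` field `g t y = (b * φ y) • W y`).

HONEST FRAMING.  ODE / kernel bookkeeping for the ∃-side of a HYPOTHETICAL filament-type rotating-self-similar blow-up skeleton (MODEL rung,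
negative side); nothing here is a claim about Navier–Stokes regularity or blow-up; stub F and the crux stay OPEN.
-/

set_option linter.dupNamespace false -- `NavierStokesRegularity.NavierStokesRegularity` path/namespace repetition is the tree convention

noncomputable section

namespace Summit.NavierStokesRegularity.NavierStokesRegularity.Theorems.SkeletonJ1RFrame

open Set Function Filter MeasureTheory Real Topology
open Literature.Analysis.FluidPDE
open Summit.NavierStokesRegularity.NavierStokesRegularity.Theorems.SelectionBoxRJRung
open scoped InnerProductSpace

/-! ## §1 The Rosenhead line kernel with a general constant `A > 0` -/

/-- The line kernel `((u² + A)^{3/2})⁻¹`, `A > 0`, is integrable on `ℝ` (domination by `(min 1 A)^{-3/2} (1 + u²)⁻¹`). [folklore] -/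
theorem integrable_lineKernel_core {A : ℝ} (hA : 0 < A) :
    Integrable fun u : ℝ => ((u ^ 2 + A) ^ (3 / 2 : ℝ))⁻¹ := by
  set m : ℝ := min 1 A with hm
  have hm0 : 0 < m := lt_min one_pos hA
  have hb : ∀ u : ℝ, 0 < u ^ 2 + A := fun u => by positivity
  have hc : Continuous fun u : ℝ => ((u ^ 2 + A) ^ (3 / 2 : ℝ))⁻¹ :=
    (((continuous_pow 2).add continuous_const).rpow_const fun u => Or.inr (by norm_num)).inv₀
      fun u => (Real.rpow_pos_of_pos (hb u) _).ne'
  refine (integrable_inv_one_add_sq.const_mul ((m ^ (3 / 2 : ℝ))⁻¹)).mono' hc.aestronglyMeasurable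
    (Eventually.of_forall fun u => ?_)
  rw [norm_inv, Real.norm_of_nonneg (Real.rpow_nonneg (hb u).le _)]
  have h1 : m * (1 + u ^ 2) ≤ u ^ 2 + A := by
    have : m ≤ 1 := min_le_left _ _
    have : m ≤ A := min_le_right _ _
    nlinarith [sq_nonneg u]
  have h2 : (m * (1 + u ^ 2)) ^ (3 / 2 : ℝ) ≤ (u ^ 2 + A) ^ (3 / 2 : ℝ) :=
    Real.rpow_le_rpow (by positivity) h1 (by norm_num)
  have h3 : 0 < (m * (1 + u ^ 2)) ^ (3 / 2 : ℝ) := Real.rpow_pos_of_pos (by positivity) _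
  calc ((u ^ 2 + A) ^ (3 / 2 : ℝ))⁻¹ ≤ ((m * (1 + u ^ 2)) ^ (3 / 2 : ℝ))⁻¹ := inv_anti₀ h3 h2
    _ = (m ^ (3 / 2 : ℝ))⁻¹ * ((1 + u ^ 2) ^ (3 / 2 : ℝ))⁻¹ := by
        rw [Real.mul_rpow hm0.le (by positivity), mul_inv]
    _ ≤ (m ^ (3 / 2 : ℝ))⁻¹ * (1 + u ^ 2)⁻¹ := by
        refine mul_le_mul_of_nonneg_left ?_ (inv_nonneg.2 (Real.rpow_nonneg hm0.le _))
        have hq : (1 : ℝ) ≤ 1 + u ^ 2 := by nlinarith [sq_nonneg u]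
        have hq0 : 0 < 1 + u ^ 2 := by positivity
        refine inv_anti₀ hq0 ?_
        calc (1 + u ^ 2) = (1 + u ^ 2) ^ (1 : ℝ) := (Real.rpow_one _).symm
          _ ≤ (1 + u ^ 2) ^ (3 / 2 : ℝ) := Real.rpow_le_rpow_of_exponent_le hq (by norm_num)

/-- The primitive `u ↦ u / (A √(u² + A))` of the line kernel (`A > 0`). [folklore] -/
theorem hasDerivAt_lineKernel_primitive' {A : ℝ} (hA : 0 < A) (u : ℝ) :
    HasDerivAt (fun u : ℝ => u / (A * Real.sqrt (u ^ 2 + A))) (((u ^ 2 + A) ^ (3 / 2 : ℝ))⁻¹) u := by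
  have hb : 0 < u ^ 2 + A := by positivity
  have hs : 0 < Real.sqrt (u ^ 2 + A) := Real.sqrt_pos.2 hb
  have h1 : HasDerivAt (fun u : ℝ => u ^ 2 + A) (2 * u) u := by
    simpa using (hasDerivAt_pow 2 u).add_const A
  have h2 : HasDerivAt (fun u : ℝ => A * Real.sqrt (u ^ 2 + A)) (A * (2 * u / (2 * Real.sqrt (u ^ 2 + A)))) u :=
    (h1.sqrt hb.ne').const_mul A
  refine ((hasDerivAt_id' u).div h2 (mul_pos hA hs).ne').congr_deriv ?_
  rw [show (u ^ 2 + A) ^ (3 / 2 : ℝ) = (u ^ 2 + A) * Real.sqrt (u ^ 2 + A) by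
    rw [show (3 / 2 : ℝ) = 1 + 1 / 2 by norm_num, Real.rpow_add hb, Real.rpow_one, Real.sqrt_eq_rpow]]
  have hsq : Real.sqrt (u ^ 2 + A) ^ 2 = u ^ 2 + A := Real.sq_sqrt hb.le
  generalize Real.sqrt (u ^ 2 + A) = s at hs hsq ⊢
  rw [← hsq]
  field_simp
  linear_combination hsq

/-- `u / √(u² + A) → 1` as `u → +∞` (`A > 0`). [folklore] -/
theorem tendsto_div_sqrt_sq_add_atTop' {A : ℝ} (hA : 0 < A) :
    Tendsto (fun u : ℝ => u / Real.sqrt (u ^ 2 + A)) atTop (𝓝 1) := by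
  have h1 : Tendsto (fun u : ℝ => A / (u ^ 2 + A)) atTop (𝓝 0) :=
    tendsto_const_nhds.div_atTop (tendsto_atTop_add_const_right _ _ (tendsto_pow_atTop two_ne_zero))
  have h2 : Tendsto (fun u : ℝ => Real.sqrt (1 - A / (u ^ 2 + A))) atTop (𝓝 1) := by
    simpa using ((tendsto_const_nhds : Tendsto (fun _ : ℝ => (1 : ℝ)) atTop (𝓝 1)).sub h1).sqrt
  refine h2.congr' ?_
  filter_upwards [eventually_ge_atTop (0 : ℝ)] with u hu
  have hb : 0 < u ^ 2 + A := by positivity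
  rw [show 1 - A / (u ^ 2 + A) = u ^ 2 / (u ^ 2 + A) by field_simp; ring,
    Real.sqrt_div' _ hb.le, Real.sqrt_sq hu]

/-- `∫ ((u² + A)^{3/2})⁻¹ du = 2 / A` over `ℝ` for every `A > 0`. [folklore] -/
theorem integral_lineKernel_core {A : ℝ} (hA : 0 < A) :
    ∫ u : ℝ, ((u ^ 2 + A) ^ (3 / 2 : ℝ))⁻¹ = 2 / A := by
  have htop : Tendsto (fun u : ℝ => u / (A * Real.sqrt (u ^ 2 + A))) atTop (𝓝 A⁻¹) := by
    have h := (tendsto_div_sqrt_sq_add_atTop' hA).const_mul A⁻¹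
    rw [mul_one] at h
    refine h.congr fun u => ?_
    ring
  have hbot : Tendsto (fun u : ℝ => u / (A * Real.sqrt (u ^ 2 + A))) atBot (𝓝 (-A⁻¹)) := by
    refine ((htop.comp tendsto_neg_atBot_atTop).neg).congr fun u => ?_
    simp only [Function.comp_apply, neg_sq, neg_div, neg_neg]
  rw [integral_of_hasDerivAt_of_tendsto (hasDerivAt_lineKernel_primitive' hA)
    (integrable_lineKernel_core hA) hbot htop]
  ring

/-! ## §2 The straight-line Biot–Savart field with core constant `a > 0`: closed form, smoothness, size -/

/-- `t × (v − σ t) = t × v`. [folklore] -/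
theorem cross_sub_smul_self' (t v : EuclideanSpace ℝ (Fin 3)) (σ : ℝ) : cross t (v - σ • t) = cross t v := by
  rw [← crossCLM_apply, map_sub, map_smul, crossCLM_apply, crossCLM_apply]
  have : cross t t = 0 := by simp [cross]
  rw [this, smul_zero, sub_zero]

/-- `‖v − σ t‖² + a = (σ − ⟨v, t⟩)² + (‖v‖² − ⟨v, t⟩² + a)` for a unit vector `t`. [folklore] -/
theorem norm_sub_smul_sq_add_core (t v : EuclideanSpace ℝ (Fin 3)) (ht : ‖t‖ = 1) (σ a : ℝ) :
    ‖v - σ • t‖ ^ 2 + a = (σ - inner ℝ v t) ^ 2 + (‖v‖ ^ 2 - (inner ℝ v t) ^ 2 + a) := by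
  rw [norm_sub_sq_real, real_inner_smul_right, norm_smul, Real.norm_eq_abs, ht, mul_one, sq_abs]
  ring

/-- `⟨v, t⟩² ≤ ‖v‖²` for a unit vector `t`; hence the squared distance to the line `‖v‖² − ⟨v, t⟩²` is `≥ 0`. [folklore] -/
theorem inner_sq_le_norm_sq_of_unit (t v : EuclideanSpace ℝ (Fin 3)) (ht : ‖t‖ = 1) :
    (inner ℝ v t) ^ 2 ≤ ‖v‖ ^ 2 := by
  have h : |inner ℝ v t| ≤ ‖v‖ := by simpa [ht] using abs_real_inner_le_norm v t
  have h' := abs_le.mp h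
  nlinarith [sq_le_sq' h'.1 h'.2]

/-- **Line Biot–Savart with a general core constant** (`a > 0`, `‖t‖ = 1`): the regularised kernel integrates along the line
`σ ↦ W + σ t` to the Lorentzian `2/(d² + a)`, `d² = ‖y − W‖² − ⟨y − W, t⟩²`, times the constant vector `t × (y − W)`; the integrand
is Bochner integrable. [folklore] -/
theorem lineBiotSavart_core {a : ℝ} (ha : 0 < a) (W t y : EuclideanSpace ℝ (Fin 3)) (ht : ‖t‖ = 1) :
    Integrable (fun σ : ℝ => ((‖y - (W + σ • t)‖ ^ 2 + a) ^ (3 / 2 : ℝ))⁻¹ • cross t (y - (W + σ • t))) ∧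
      ∫ σ : ℝ, ((‖y - (W + σ • t)‖ ^ 2 + a) ^ (3 / 2 : ℝ))⁻¹ • cross t (y - (W + σ • t)) =
        (2 / (‖y - W‖ ^ 2 - (inner ℝ (y - W) t) ^ 2 + a)) • cross t (y - W) := by
  set v := y - W with hv
  have hA : 0 < ‖v‖ ^ 2 - (inner ℝ v t) ^ 2 + a := by
    have := inner_sq_le_norm_sq_of_unit t v ht
    linarith
  have hfun : (fun σ : ℝ => ((‖y - (W + σ • t)‖ ^ 2 + a) ^ (3 / 2 : ℝ))⁻¹ • cross t (y - (W + σ • t)))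
      = fun σ => (((σ - inner ℝ v t) ^ 2 + (‖v‖ ^ 2 - (inner ℝ v t) ^ 2 + a)) ^ (3 / 2 : ℝ))⁻¹ • cross t v := by
    funext σ
    rw [show y - (W + σ • t) = v - σ • t by rw [hv]; abel, cross_sub_smul_self', norm_sub_smul_sq_add_core t v ht σ a]
  rw [hfun, integral_smul_const]
  refine ⟨((integrable_lineKernel_core hA).comp_sub_right (inner ℝ v t)).smul_const _, ?_⟩
  rw [(integral_sub_right_eq_self (fun u : ℝ => ((u ^ 2 + (‖v‖ ^ 2 - (inner ℝ v t) ^ 2 + a)) ^ (3 / 2 : ℝ))⁻¹)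
    (inner ℝ v t)).trans (integral_lineKernel_core hA)]

/-- The closed-form line field `y ↦ (2/(‖y − W‖² − ⟨y − W, t⟩² + a)) • t × (y − W)` is `C^∞` (`a > 0`, `‖t‖ = 1`). [folklore] -/
theorem contDiff_lineField {a : ℝ} (ha : 0 < a) (W t : EuclideanSpace ℝ (Fin 3)) (ht : ‖t‖ = 1) {n : WithTop ℕ∞} :
    ContDiff ℝ n (fun y : EuclideanSpace ℝ (Fin 3) => (2 / (‖y - W‖ ^ 2 - (inner ℝ (y - W) t) ^ 2 + a)) • cross t (y - W)) := by
  have hden : ContDiff ℝ n (fun y : EuclideanSpace ℝ (Fin 3) => ‖y - W‖ ^ 2 - (inner ℝ (y - W) t) ^ 2 + a) :=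
    (((contDiff_norm_sq ℝ).comp (contDiff_id.sub contDiff_const)).sub
      (((contDiff_id.sub contDiff_const).inner ℝ contDiff_const).pow 2)).add contDiff_const
  have hne : ∀ y : EuclideanSpace ℝ (Fin 3), ‖y - W‖ ^ 2 - (inner ℝ (y - W) t) ^ 2 + a ≠ 0 := fun y => by
    have := inner_sq_le_norm_sq_of_unit t (y - W) ht
    linarith
  have hcr : ContDiff ℝ n (fun y : EuclideanSpace ℝ (Fin 3) => cross t (y - W)) := by
    have : (fun y : EuclideanSpace ℝ (Fin 3) => cross t (y - W)) = fun y => crossCLM t (y - W) := by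
      funext y; rw [crossCLM_apply]
    rw [this]
    exact (crossCLM t).contDiff.comp (contDiff_id.sub contDiff_const)
  exact (contDiff_const.div hden hne).smul hcr

/-- `‖t × v‖² = ‖v‖² − ⟨v, t⟩²` for a unit vector `t` (Lagrange's identity, via `‖t × v‖ = ‖t‖‖v‖ sin ∠` and
`⟨t, v⟩ = ‖t‖‖v‖ cos ∠`). [folklore] -/
theorem norm_cross_sq_of_unit (t v : EuclideanSpace ℝ (Fin 3)) (ht : ‖t‖ = 1) :
    ‖cross t v‖ ^ 2 = ‖v‖ ^ 2 - (inner ℝ v t) ^ 2 := by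
  have hθ := norm_cross t v
  have hcos : Real.cos (InnerProductGeometry.angle t v) * (‖t‖ * ‖v‖) = inner ℝ t v :=
    InnerProductGeometry.cos_angle_mul_norm_mul_norm t v
  rw [ht, one_mul] at hθ hcos
  rw [real_inner_comm, ← hcos, hθ, mul_pow, mul_pow]
  nlinarith [Real.sin_sq_add_cos_sq (InnerProductGeometry.angle t v)]

/-- Size of the line field: with `D = ‖y − W‖² − ⟨y − W, t⟩²` the squared distance from `y` to the line and any `0 < d'` with
`d'² ≤ D`, `‖(2/(D + a)) • t × (y − W)‖ = 2√D/(D + a) ≤ 2/d'`: the field of a line seen from distance `≥ d'` is at most `2/d'` per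
unit kernel strength (`a > 0`, `‖t‖ = 1`). [folklore] -/
theorem norm_lineField_le {a : ℝ} (ha : 0 < a) (W t y : EuclideanSpace ℝ (Fin 3)) (ht : ‖t‖ = 1) {d' : ℝ} (hd' : 0 < d')
    (hfar : d' ^ 2 ≤ ‖y - W‖ ^ 2 - (inner ℝ (y - W) t) ^ 2) :
    ‖(2 / (‖y - W‖ ^ 2 - (inner ℝ (y - W) t) ^ 2 + a)) • cross t (y - W)‖ ≤ 2 / d' := by
  set D := ‖y - W‖ ^ 2 - (inner ℝ (y - W) t) ^ 2 with hD
  have hD0 : 0 ≤ D := le_trans (sq_nonneg _) hfar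
  have hDa : 0 < D + a := by linarith
  have hcr : ‖cross t (y - W)‖ = Real.sqrt D := by
    rw [← Real.sqrt_sq (norm_nonneg _), norm_cross_sq_of_unit t (y - W) ht]
  have hsD : d' ≤ Real.sqrt D := (Real.le_sqrt' hd').2 hfar
  have hsq : Real.sqrt D * Real.sqrt D = D := Real.mul_self_sqrt hD0
  rw [norm_smul, hcr, Real.norm_of_nonneg (by positivity : (0:ℝ) ≤ 2 / (D + a)), div_mul_eq_mul_div,
    div_le_div_iff₀ hDa hd']
  nlinarith [Real.sqrt_nonneg D, mul_le_mul_of_nonneg_left hsD (Real.sqrt_nonneg D)]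

/-! ## §3 Global shooting for the position-cut-off local-induction equation -/

/-- **The position-cut-off local-induction equation (existence).**  For `φ : ℝ³ → ℝ` and `W : ℝ³ → ℝ³` of class `C¹`, any
coefficient `b : ℝ` and Cauchy data `(P, e)` with `‖e‖ = 1`, the equation `x″ = (b·φ(x)) • x′ × W(x)` — the shape of
`SkeletonJ1RFrame.IsLiaReference` (`b = β_j⁻¹`, `φ` the reference cutoff, `W` the ambient field) — has a global `C²` UNIT-SPEED
solution on `ℝ` with `x 0 = P`, `x′ 0 = e`.  (The tree's `SelectionBoxRJRung.cutoffLia_exists` with the parameter-independent,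
jointly `C¹` field `(t, y) ↦ (b·φ y) • W y`; the right side is `⟂ x′`, so unit speed propagates, and has linear growth.) [folklore] -/
theorem positionCutoffLia_exists {φ : EuclideanSpace ℝ (Fin 3) → ℝ} {W : EuclideanSpace ℝ (Fin 3) → EuclideanSpace ℝ (Fin 3)}
    (hφ : ContDiff ℝ 1 φ) (hW : ContDiff ℝ 1 W) (b : ℝ) (P : EuclideanSpace ℝ (Fin 3)) {e : EuclideanSpace ℝ (Fin 3)}
    (he : ‖e‖ = 1) :
    ∃ x : ℝ → EuclideanSpace ℝ (Fin 3), ContDiff ℝ 2 x ∧ x 0 = P ∧ deriv x 0 = e ∧ (∀ τ, ‖deriv x τ‖ = 1) ∧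
      ∀ τ, iteratedDeriv 2 x τ = (b * φ (x τ)) • cross (deriv x τ) (W (x τ)) := by
  have hcF : ContDiff ℝ 1 (fun q : ℝ × EuclideanSpace ℝ (Fin 3) => (1 : ℝ) • ((b * φ q.2) • W q.2)) := by
    exact (contDiff_const (c := (1 : ℝ))).smul
      (((contDiff_const (c := b)).mul (hφ.comp contDiff_snd)).smul (hW.comp contDiff_snd))
  obtain ⟨x, hx, h0, h0', hunit, hode⟩ :=
    cutoffLia_exists (fun _ => (1 : ℝ)) (fun _ y => (b * φ y) • W y) hcF P he
  refine ⟨x, hx, h0, h0', hunit, fun τ => ?_⟩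
  rw [hode τ, one_smul, ← crossCLM_apply, map_smul, crossCLM_apply]

/-- **The position-cut-off local-induction equation (uniqueness).**  Two `C²` curves with the same Cauchy data at `0` solving
`x″ = (b·φ(x)) • x′ × W(x)` (`φ`, `W` of class `C¹`) coincide on `ℝ`. [folklore] -/
theorem positionCutoffLia_unique {φ : EuclideanSpace ℝ (Fin 3) → ℝ} {W : EuclideanSpace ℝ (Fin 3) → EuclideanSpace ℝ (Fin 3)}
    (hφ : ContDiff ℝ 1 φ) (hW : ContDiff ℝ 1 W) (b : ℝ) {x y : ℝ → EuclideanSpace ℝ (Fin 3)}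
    (hx : ContDiff ℝ 2 x) (hy : ContDiff ℝ 2 y) (h0 : x 0 = y 0) (h0' : deriv x 0 = deriv y 0)
    (hxo : ∀ τ, iteratedDeriv 2 x τ = (b * φ (x τ)) • cross (deriv x τ) (W (x τ)))
    (hyo : ∀ τ, iteratedDeriv 2 y τ = (b * φ (y τ)) • cross (deriv y τ) (W (y τ))) : x = y := by
  have hcF : ContDiff ℝ 1 (fun q : ℝ × EuclideanSpace ℝ (Fin 3) => (1 : ℝ) • ((b * φ q.2) • W q.2)) := by
    exact (contDiff_const (c := (1 : ℝ))).smul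
      (((contDiff_const (c := b)).mul (hφ.comp contDiff_snd)).smul (hW.comp contDiff_snd))
  refine cutoffLia_unique (fun _ => (1 : ℝ)) (fun _ y => (b * φ y) • W y) hcF hx hy h0 h0' (fun τ => ?_) (fun τ => ?_)
  · rw [hxo τ, one_smul, ← crossCLM_apply, ← crossCLM_apply, map_smul]
  · rw [hyo τ, one_smul, ← crossCLM_apply, ← crossCLM_apply, map_smul]

/-! ## §4 Turning bookkeeping for unit-speed `C²` curves (the ingredients of the admissibility bootstrap) -/

/-- **Turning bound.**  If `‖x″‖ ≤ κ` on `[a, b]` then `‖x′ b − x′ a‖ ≤ κ (b − a)` (mean value inequality for `x′`). [folklore] -/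
theorem norm_deriv_sub_le_of_curvature_le {x : ℝ → EuclideanSpace ℝ (Fin 3)} (hx : ContDiff ℝ 2 x) {a b κ : ℝ} (hab : a ≤ b)
    (hκ : ∀ τ ∈ Icc a b, ‖iteratedDeriv 2 x τ‖ ≤ κ) : ‖deriv x b - deriv x a‖ ≤ κ * (b - a) := by
  have hTd : Differentiable ℝ (deriv x) := hx.differentiable_deriv_two
  have h2 : iteratedDeriv 2 x = deriv (deriv x) := by rw [iteratedDeriv_succ, iteratedDeriv_one]
  have hκ' : ∀ τ ∈ Icc a b, ‖deriv (deriv x) τ‖ ≤ κ := fun τ hτ => by rw [← h2]; exact hκ τ hτ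
  have h := Convex.norm_image_sub_le_of_norm_deriv_le (f := deriv x) (fun v _ => hTd v) hκ' (convex_Icc a b)
    (left_mem_Icc.2 hab) (right_mem_Icc.2 hab)
  rwa [Real.norm_eq_abs, abs_of_nonneg (sub_nonneg.2 hab)] at h

/-- **No turning where the curvature vanishes.**  If `x″ = 0` on `[a, b]` then `x′ b = x′ a`. [folklore] -/
theorem deriv_eq_of_curvature_zero {x : ℝ → EuclideanSpace ℝ (Fin 3)} (hx : ContDiff ℝ 2 x) {a b : ℝ} (hab : a ≤ b)
    (h0 : ∀ τ ∈ Icc a b, iteratedDeriv 2 x τ = 0) : deriv x b = deriv x a := by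
  have h := norm_deriv_sub_le_of_curvature_le hx hab (κ := 0) fun τ hτ => by rw [h0 τ hτ, norm_zero]
  rw [zero_mul] at h
  exact sub_eq_zero.1 (norm_le_zero_iff.1 h)

/-- **Axial progress of a near-straight arc.**  If `x` is `C¹` with `‖x′ τ − a‖ ≤ θ` for `τ ∈ [0, T]` (`‖a‖ = 1`), then
`⟪x τ − x 0, a⟫ ≥ (1 − θ) τ` for `τ ∈ [0, T]`. [folklore] -/
theorem inner_progress_of_nearStraightOn {x : ℝ → EuclideanSpace ℝ (Fin 3)} (hx : ContDiff ℝ 1 x) {a : EuclideanSpace ℝ (Fin 3)}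
    (ha : ‖a‖ = 1) {θ T : ℝ} (hθ : ∀ τ ∈ Icc 0 T, ‖deriv x τ - a‖ ≤ θ) {τ : ℝ} (hτ : τ ∈ Icc 0 T) :
    (1 - θ) * τ ≤ inner ℝ (x τ - x 0) a := by
  have hxd : Differentiable ℝ x := hx.differentiable (by norm_num)
  set ψ : ℝ → ℝ := fun v => inner ℝ (x v) a - (1 - θ) * v with hψ
  have hψd : ∀ v, HasDerivAt ψ (inner ℝ (deriv x v) a - (1 - θ)) v := by
    intro v
    have h1 : HasDerivAt (fun v => inner ℝ (x v) a) (inner ℝ (x v) (0 : EuclideanSpace ℝ (Fin 3)) + inner ℝ (deriv x v) a) v :=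
      (hxd v).hasDerivAt.inner ℝ (hasDerivAt_const v a)
    rw [inner_zero_right, zero_add] at h1
    have h2 : HasDerivAt (fun v : ℝ => (1 - θ) * v) (1 - θ) v := by
      simpa using (hasDerivAt_id v).const_mul (1 - θ)
    exact h1.sub h2
  have hψ' : ∀ v ∈ interior (Icc 0 T), 0 ≤ deriv ψ v := by
    intro v hv
    rw [interior_Icc] at hv
    rw [(hψd v).deriv]
    have hsplit : inner ℝ (deriv x v) a = inner ℝ a a + inner ℝ (deriv x v - a) a := by
      rw [← inner_add_left, add_sub_cancel]
    have haa : inner ℝ a a = (1 : ℝ) := by rw [real_inner_self_eq_norm_sq, ha, one_pow]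
    have hcs : |inner ℝ (deriv x v - a) a| ≤ ‖deriv x v - a‖ * ‖a‖ := abs_real_inner_le_norm _ _
    rw [ha, mul_one] at hcs
    have := neg_abs_le (inner ℝ (deriv x v - a) a)
    linarith [hθ v (Ioo_subset_Icc_self hv)]
  have hmono : MonotoneOn ψ (Icc 0 T) :=
    monotoneOn_of_deriv_nonneg (convex_Icc 0 T) (fun v _ => (hψd v).continuousAt.continuousWithinAt)
      (fun v _ => (hψd v).differentiableAt.differentiableWithinAt) hψ'
  have h0T : (0 : ℝ) ∈ Icc 0 T := ⟨le_rfl, hτ.1.trans hτ.2⟩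
  have h := hmono h0T hτ hτ.1
  simp only [hψ, mul_zero, sub_zero] at h
  rw [inner_sub_left]
  linarith

end Summit.NavierStokesRegularity.NavierStokesRegularity.Theorems.SkeletonJ1RFrame

end
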